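import Literature.Topology.FourManifolds.LatticeFormsEichlerTransitivity
import Literature.Topology.FourManifolds.LatticeFormsWallGeneratorsStable
import HarnessLib

/-!
# Eichler transvections of one hyperbolic plane act transitively on hyperbolic frames (Wall 1964, p. 145, via GHS 2009, Prop. 3.3 (i), (ii))

Topic `Literature/Topology/FourManifolds`; sequel of `LatticeFormsEichlerTransitivity.lean`
(`exists_uGens_apply_eq`, the Eichler criterion for an isotropic vector with a dual vector) and
`LatticeFormsWallGeneratorsStable.lean` (Kirby's generating set `wallGenerators` of
`O(Q ⊕ H)` and words `IsWordIn`), written for the regluing step of Wall's theorem on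
h-cobordism (C. T. C. Wall, *On simply-connected 4-manifolds*, J. London Math. Soc. 39 (1964),
Thm. 2, proof §2, p. 145: "for some automorph `T` of `H₂(∂V)`, `T(L) = K`: this is quite a
simple result … by [11] there is a diffeomorphism of `∂V` which induces `T`"; R. C. Kirby, *The
topology of 4-manifolds*, LNM 1374 (1989), Ch. X, proof of Thm. 1, p. 56: "we need to realize the
automorphism `g_* = (φ ⊕ ψ) d_*⁻¹` … by a diffeomorphism `g`. This can be done by Theorem 2").
What the regluing consumes (`HCobordismKirby.lean`,
`isHCobordant_of_isStabilization_of_realisedOnFrames`) is only an automorphism realised by a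
diffeomorphism that AGREES WITH a given isometry `A` ON A HYPERBOLIC FRAME. This file proves the
lattice-theoretic statement that produces such an automorphism from the realisation of Kirby's
generators of ONE `S² × S²` summand alone (the handle-slide transvections `A_a`, `A'_a` and
`1 ⊕ O(H)`, `wallGenerators`), with NO generation theorem for `O(Q ⊕ H)` (Wall 1962/1963,
Kneser), whenever enough pairwise orthogonal hyperbolic planes are present:

* `exists_uGens_apply_eq_fixing` — the Eichler criterion of GHS Prop. 3.3 (i) in the form needed
  for frames: for a symmetric integral form with two orthogonal hyperbolic pairs `(x, y)`,
  `(x₁, y₁)` (no evenness of the form: only the dual vector `z` of the isotropic vector `u`,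
  `u·z = 1`, has to have even square, as it does when `z` is isotropic), an admissible word in the
  transvections `E(y, a, q)`, `E(x, a, q)` (`a ⊥ x, y`, `a·a = 2q`) carries `u` to `y` AND FIXES
  every vector orthogonal to `x, y, x₁, y₁, u, z` (all the arguments `a` of the word are
  orthogonal to such vectors) — GHS's proof verbatim, keeping track of the arguments;
* `exists_isWordIn_planeGens_apply_eq` — **frame transport**:
  given pairwise orthogonal hyperbolic pairs `(x_j, y_j)_{j < K}` and one more hyperbolic pair
  `(x₀, y₀)` orthogonal to all of them, every hyperbolic `K`-frame `(u, u')` (`u_i·u_j = 0`,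
  `u'_i·u'_j = 0`, `u_i·u'_j = δ_{ij}`) is carried to `(y_j)_j` on its isotropic half by a word in
  the admissible transvections of the planes `(x_j, y_j)` (induction on `j`: the word placing
  `u_j` at `y_j` is taken from `exists_uGens_apply_eq_fixing` for the pairs `(x_j, y_j)`,
  `(x₀, y₀)` and fixes `y_i`, `i < j`);
* `isWordIn_wallGenerators_of_eichlerTransvection`, `isWordIn_wallGenerators_of_mem_planeGens`
  — GHS Prop. 3.3 (ii) in Kirby's coordinates: in `Q ⊕ H` with a hyperbolic pair `(x₀, y₀)`
  orthogonal to `H`, every transvection `E(e', a, q)` based at an isotropic `e'` with an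
  isotropic dual (in particular every admissible transvection of ANY hyperbolic plane `(x', y')`
  of `Q ⊕ H`) is a word in `wallGenerators` (conjugate a generator of the `H`-plane by the word
  carrying `e'` to `y = (0, (0,1))`);
* `exists_isWordIn_wallGenerators_apply_eq_of_frame` — the statement consumed by the regluing:
  in `Q ⊕ H`, given `K` pairwise orthogonal hyperbolic pairs and one more orthogonal to them and
  to `H` (in the application: the planes of the other `S² × S²` summands, `H` itself, and a
  hyperbolic pair of the core), for every isometry `A` of `Q ⊕ H` and every hyperbolic `K`-frame
  `(u, u')` some word `φ` in `wallGenerators` has `φ (u i) = A (u i)` for all `i`.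

Everything is proved; no named fact is introduced. NOT here: anything for cores without a
hyperbolic plane (definite forms, `⟨1⟩ ⊕ ⟨-1⟩`), where the last step of the induction has no spare
plane and the statement is the generation theorem itself (Wall 1963; GHS Prop. 3.4 via Kneser).

## Full frames (appended)

* `exists_isWordIn_wallGenerators_endgame`, `exists_isWordIn_wallGenerators_apply_eq_std_of_fullFrame`,
  `exists_isWordIn_wallGenerators_apply_eq_of_fullFrame` — the same conclusion for a FULL
  hyperbolic `(K+1)`-frame of `Q ⊕ H` when the `K` target planes and `H` exhaust the lattice
  (`Q ≅ K·H`, no spare plane): the last vector is finished by Kirby's `1 ⊕ O(H)` (swap, `−1`) and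
  one transvection `A'_a` — the input of the Lagrangian mover on `𝕊⁴ # k(S² × S²)` in Wall's
  trick (`HCobordismWallFilling.lean` and sequel).

## References

* V. Gritsenko, K. Hulek, G. K. Sankaran, *Abelianisation of orthogonal groups and the
  fundamental group of modular varieties*, J. Algebra 322 (2009) 463–478, arXiv:0810.1614, §3,
  Lemma 3.2, Prop. 3.3 (i), (ii) and their proofs (p. 469). [GritsenkoHulekSankaran2009]
* C. T. C. Wall, *On simply-connected 4-manifolds*, J. London Math. Soc. 39 (1964) 141–149, §2,
  p. 145. [WallJLMS1964]
* R. C. Kirby, *The topology of 4-manifolds*, LNM 1374 (1989), Ch. X, proof of Thm. 1 (p. 56) and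
  of Thm. 2 (pp. 61–62). [Kirby1989]
-/

noncomputable section

open Module
open LinearMap (BilinForm)

namespace Literature.Topology.FourManifolds

variable {W : Type*} [AddCommGroup W] {B : BilinForm ℤ W} {x y : W}

/-! ### Arguments of generators; words fixing a vector -/

namespace UGen

/-- The argument `a` of a generator `E(y, a, q)` or `E(x, a, q)`. [folklore] -/
def arg : UGen W → W
  | atY a _ => a
  | atX a _ => a

omit [AddCommGroup W] in
/-- `arg (E(y,a,q)) = a`. [folklore] -/
@[simp] theorem arg_atY (a : W) (q : ℤ) : (atY a q : UGen W).arg = a := rfl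

omit [AddCommGroup W] in
/-- `arg (E(x,a,q)) = a`. [folklore] -/
@[simp] theorem arg_atX (a : W) (q : ℤ) : (atX a q : UGen W).arg = a := rfl

/-- The inverse generator has the opposite argument. [folklore] -/
@[simp] theorem arg_inv (g : UGen W) : g.inv.arg = -g.arg := by
  cases g <;> rfl

variable (B x y) in
/-- A generator fixes every vector orthogonal to `x`, `y` and to its argument:
`E(e, a, q) p = p + (e·p) a - (a·p) e - q (e·p) e = p`. [folklore] -/
theorem toLinearMap_apply_eq_self {g : UGen W} {p : W} (hxp : B x p = 0) (hyp : B y p = 0)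
    (hg : B g.arg p = 0) : g.toLinearMap B x y p = p := by
  cases g with
  | atY a q =>
    change B.eichlerTransvection y a q p = p
    rw [arg_atY] at hg
    simp [hyp, hg]
  | atX a q =>
    change B.eichlerTransvection x a q p = p
    rw [arg_atX] at hg
    simp [hxp, hg]

variable (B x y) in
/-- A word all of whose arguments are orthogonal to `p ⊥ x, y` fixes `p`. [folklore] -/
theorem eval_apply_eq_self {l : List (UGen W)} {p : W} (hxp : B x p = 0) (hyp : B y p = 0)
    (hl : ∀ g ∈ l, B g.arg p = 0) : eval B x y l p = p := by
  induction l with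
  | nil => rfl
  | cons g l ih =>
    rw [eval_cons, LinearMap.comp_apply, ih fun g' hg' => hl g' (List.mem_cons_of_mem g hg'),
      toLinearMap_apply_eq_self B x y hxp hyp (hl g List.mem_cons_self)]

/-- The arguments of an inverse word are orthogonal to whatever the arguments of the word are
orthogonal to. [folklore] -/
theorem arg_ortho_of_mem_invWord {l : List (UGen W)} {p : W} (hl : ∀ g ∈ l, B g.arg p = 0)
    {g : UGen W} (hg : g ∈ invWord l) : B g.arg p = 0 := by
  simp only [invWord, List.mem_reverse, List.mem_map] at hg
  obtain ⟨g', hg', rfl⟩ := hg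
  rw [arg_inv, map_neg, LinearMap.neg_apply, hl g' hg', neg_zero]

end UGen

/-! ### GHS Lemma 3.2 with the arguments recorded -/

section Ortho

variable {x₁ y₁ : W}

/-- The arguments of the row generators lie in `⟨x₁, y₁⟩`, so they are orthogonal to every
`p ⊥ x₁, y₁`. [cite: GritsenkoHulekSankaran2009, Lemma 3.2] -/
theorem arg_rowGen_ortho (t : Matrix.TransvectionStruct (Fin 2) ℤ) {p : W} (hx₁p : B x₁ p = 0)
    (hy₁p : B y₁ p = 0) : B (rowGen x₁ y₁ t).arg p = 0 := by
  unfold rowGen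
  split_ifs <;> simp [hx₁p, hy₁p]

/-- The arguments of the column generators lie in `⟨x₁, y₁⟩`, so they are orthogonal to every
`p ⊥ x₁, y₁`. [cite: GritsenkoHulekSankaran2009, Lemma 3.2] -/
theorem arg_colGen_ortho (t : Matrix.TransvectionStruct (Fin 2) ℤ) {p : W} (hx₁p : B x₁ p = 0)
    (hy₁p : B y₁ p = 0) : B (colGen x₁ y₁ t).arg p = 0 := by
  unfold colGen
  split_ifs <;> simp [hx₁p, hy₁p]

variable (h : TwoHyperbolicPairs B x y x₁ y₁)
include h

/-- **GHS Lemma 3.2 (second assertion), arguments recorded**: every `u` is moved into `U^⊥` by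
an admissible word in `E(y, k x₁)`, `E(y, k y₁)`, `E(x, k x₁)`, `E(x, k y₁)`, all of whose
arguments are orthogonal to every `p ⊥ x₁, y₁` (proof as `exists_uGens_ortho`: elementary row
and column operations diagonalise the coordinate matrix `X(u)`).
[cite: GritsenkoHulekSankaran2009, Lemma 3.2] -/
theorem exists_uGens_ortho_fixing (u : W) :
    ∃ l : List (UGen W), (∀ g ∈ l, g.IsAdmissible B x y) ∧
      (∀ g ∈ l, ∀ p, B x₁ p = 0 → B y₁ p = 0 → B g.arg p = 0) ∧
      B x (UGen.eval B x y l u) = 0 ∧ B y (UGen.eval B x y l u) = 0 := by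
  obtain ⟨L, L', D, hD⟩ :=
    Literature.LinearAlgebra.Matrix.exists_list_transvec_mul_mul_list_transvec_eq_diagonal_int
      (ghsMatrix B x y x₁ y₁ u)
  have hX : ghsMatrix B x y x₁ y₁ (UGen.eval B x y
      ((L'.map (colGen x₁ y₁)).reverse ++ L.map (rowGen x₁ y₁)) u) = Matrix.diagonal D := by
    rw [UGen.eval_append, LinearMap.comp_apply, ghsMatrix_eval_reverse_map_colGen h,
      ghsMatrix_eval_map_rowGen h, hD]
  refine ⟨(L'.map (colGen x₁ y₁)).reverse ++ L.map (rowGen x₁ y₁), fun g hg => ?_,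
    fun g hg p hx₁p hy₁p => ?_, ?_, ?_⟩
  · simp only [List.mem_append, List.mem_reverse, List.mem_map] at hg
    rcases hg with ⟨t, -, rfl⟩ | ⟨t, -, rfl⟩
    · exact isAdmissible_colGen h t
    · exact isAdmissible_rowGen h t
  · simp only [List.mem_append, List.mem_reverse, List.mem_map] at hg
    rcases hg with ⟨t, -, rfl⟩ | ⟨t, -, rfl⟩
    · exact arg_colGen_ortho t hx₁p hy₁p
    · exact arg_rowGen_ortho t hx₁p hy₁p
  · simpa using congrFun (congrFun hX 1) 0
  · simpa using congrFun (congrFun hX 0) 1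

end Ortho

/-! ### The Eichler criterion, fixing the orthogonal complement -/

section Transitive

variable {x₁ y₁ : W} (h : TwoHyperbolicPairs B x y x₁ y₁)
include h

/-- The square of the projection `z' = z - (y·z) x - (x·z) y` to `U^⊥`:
`z'·z' = z·z - 2 (x·z)(y·z)`. [folklore] -/
theorem apply_proj_proj (z : W) :
    B (z - B y z • x - B x z • y) (z - B y z • x - B x z • y) = B z z - 2 * (B x z * B y z) := by
  have hzx : B z x = B x z := h.isSymm.eq z x
  have hzy : B z y = B y z := h.isSymm.eq z y
  simp only [map_sub, map_smul, LinearMap.sub_apply, LinearMap.smul_apply, smul_eq_mul, h.xx,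
    h.yy, h.xy, h.yx, hzx, hzy]
  ring

/-- **Eichler criterion for an isotropic vector with a dual vector of even square, fixing the
rest** (GHS Prop. 3.3 (i) for `(u,u) = 0`, `div(u) = 1`, target `y = e`; no evenness of the
form). In a symmetric integral bilinear module with two orthogonal hyperbolic pairs `(x, y)`,
`(x₁, y₁)`, let `u` be isotropic with a dual vector `z` (`u·z = 1`) of even square `z·z = 2q_z`
(e.g. `z` isotropic). Then an admissible word in the transvections `E(y, a, q)`, `E(x, a, q)`
(`a ⊥ x, y`, `a·a = 2q`) carries `u` to `y` and fixes every `p` orthogonal to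
`x, y, x₁, y₁, u, z`. Proof as printed (GHS p. 469): move `u` and `y` into `U^⊥` by Lemma 3.2
(`exists_uGens_ortho_fixing`; arguments in `U₁`), then
"`u ↦^{t(e,u')} (u - de) ↦^{t(f,w)} (v - de) ↦^{t(e,-v')} v`" (`eichler_translation`, `d = 1`,
`u'` the projection of the image of `z`, `w` the difference, `v'` the projection of the image of
`x`), and undo the word that moved `y`; the squares of `u', w, v'` are even because
`z·z`, `-2 u·v` and `x·x = 0` are (`apply_proj_proj`), and all these arguments are orthogonal to
`p` because the words are isometries fixing `p`.
[cite: GritsenkoHulekSankaran2009, Prop. 3.3 (i) (proof, p. 469)] -/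
theorem exists_uGens_apply_eq_fixing {u z : W} {qz : ℤ} (hu : B u u = 0) (huz : B u z = 1)
    (hz : B z z = qz + qz) :
    ∃ l : List (UGen W), (∀ g ∈ l, g.IsAdmissible B x y) ∧ UGen.eval B x y l u = y ∧
      ∀ p, B x p = 0 → B y p = 0 → B x₁ p = 0 → B y₁ p = 0 → B u p = 0 → B z p = 0 →
        UGen.eval B x y l p = p := by
  have hB := h.isSymm
  -- (1) move `u` into `U^⊥`, with a dual vector there
  obtain ⟨l₁, hl₁, hl₁arg, hxu₁, hyu₁⟩ := exists_uGens_ortho_fixing h u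
  set u₁ := UGen.eval B x y l₁ u with hu₁def
  have hu₁ : B u₁ u₁ = 0 := by rw [UGen.map_eval hB h.xx h.yy hl₁, hu]
  set z₁ := UGen.eval B x y l₁ z with hz₁def
  obtain ⟨hxu', hyu', huu'⟩ := exists_dual_ortho h (z := z₁) hxu₁ hyu₁
  rw [hz₁def, UGen.map_eval hB h.xx h.yy hl₁, huz] at huu'
  set u' := z₁ - B y z₁ • x - B x z₁ • y with hu'def
  -- (1') move `y` into `U^⊥`, with a dual vector there (the image of `x`)
  obtain ⟨l₂, hl₂, hl₂arg, hxv₁, hyv₁⟩ := exists_uGens_ortho_fixing h y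
  set v₁ := UGen.eval B x y l₂ y with hv₁def
  have hv₁ : B v₁ v₁ = 0 := by rw [UGen.map_eval hB h.xx h.yy hl₂, h.yy]
  set x₂ := UGen.eval B x y l₂ x with hx₂def
  obtain ⟨hxv', hyv', hvv'⟩ := exists_dual_ortho h (z := x₂) hxv₁ hyv₁
  rw [hx₂def, UGen.map_eval hB h.xx h.yy hl₂, h.yx] at hvv'
  set v' := x₂ - B y x₂ • x - B x x₂ • y with hv'def
  -- (2) the half-squares
  set q₁ : ℤ := qz - B x z₁ * B y z₁ with hq₁def
  have hq₁ : B u' u' = q₁ + q₁ := by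
    rw [hu'def, apply_proj_proj h, hz₁def, UGen.map_eval hB h.xx h.yy hl₁, hz, ← hz₁def, hq₁def]
    ring
  set q₂ : ℤ := -B u₁ v₁ with hq₂def
  have hq₂ : B (u₁ - v₁) (u₁ - v₁) = q₂ + q₂ := by
    simp only [map_sub, LinearMap.sub_apply, hu₁, hv₁, hB.eq v₁ u₁, hq₂def]
    ring
  set q₃ : ℤ := -(B x x₂ * B y x₂) with hq₃def
  have hq₃ : B v' v' = q₃ + q₃ := by
    rw [hv'def, apply_proj_proj h, hx₂def, UGen.map_eval hB h.xx h.yy hl₂, h.xx, ← hx₂def, hq₃def]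
    ring
  have hyw : B y (u₁ - v₁) = 0 := by rw [map_sub, hyu₁, hyv₁, sub_zero]
  have hxw : B x (u₁ - v₁) = 0 := by rw [map_sub, hxu₁, hxv₁, sub_zero]
  have key := eichler_translation (q₁ := q₁) (q₃ := q₃) hB h.yy h.xy one_ne_zero hxu₁ hyu₁ hyv₁
    hyw hyv' (one_smul ℤ (u₁ - v₁)) (hu₁.trans hv₁.symm) huu' hvv' hq₂
  -- (3) the word: undo `l₂` after the three transvections after `l₁`
  refine ⟨UGen.invWord l₂ ++ ([UGen.atY (-v') q₃, UGen.atX (u₁ - v₁) q₂, UGen.atY u' q₁] ++ l₁),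
    ?_, ?_, ?_⟩
  · intro g hg
    simp only [List.mem_append, List.mem_cons, List.not_mem_nil, or_false] at hg
    rcases hg with hg | (rfl | rfl | rfl) | hg
    · exact UGen.isAdmissible_of_mem_invWord hl₂ hg
    · exact ⟨by simp [hxv'], by simp [hyv'], by simpa using hq₃⟩
    · exact ⟨hxw, hyw, hq₂⟩
    · exact ⟨hxu', hyu', hq₁⟩
    · exact hl₁ g hg
  · rw [UGen.eval_append, LinearMap.comp_apply, UGen.eval_append, LinearMap.comp_apply,
      ← hu₁def]
    change UGen.eval B x y (UGen.invWord l₂) (B.eichlerTransvection y (-v') q₃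
      (B.eichlerTransvection x (u₁ - v₁) q₂ (B.eichlerTransvection y u' q₁ u₁))) = y
    rw [key, hv₁def, UGen.eval_invWord_eval hB h.xx h.yy hl₂]
  · -- every argument is orthogonal to `p`, so the word fixes `p`
    intro p hxp hyp hx₁p hy₁p hup hzp
    have hl₁p : ∀ g ∈ l₁, B g.arg p = 0 := fun g hg => hl₁arg g hg p hx₁p hy₁p
    have hl₂p : ∀ g ∈ l₂, B g.arg p = 0 := fun g hg => hl₂arg g hg p hx₁p hy₁p
    have h₁p : UGen.eval B x y l₁ p = p := UGen.eval_apply_eq_self B x y hxp hyp hl₁p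
    have h₂p : UGen.eval B x y l₂ p = p := UGen.eval_apply_eq_self B x y hxp hyp hl₂p
    -- the images under the isometries `l₁`, `l₂` of vectors orthogonal to `p` are orthogonal to `p`
    have hz₁p : B z₁ p = 0 := by
      rw [hz₁def, ← h₁p, UGen.map_eval hB h.xx h.yy hl₁]; exact hzp
    have hu₁p : B u₁ p = 0 := by
      rw [hu₁def, ← h₁p, UGen.map_eval hB h.xx h.yy hl₁]; exact hup
    have hv₁p : B v₁ p = 0 := by
      rw [hv₁def, ← h₂p, UGen.map_eval hB h.xx h.yy hl₂]; exact hyp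
    have hx₂p : B x₂ p = 0 := by
      rw [hx₂def, ← h₂p, UGen.map_eval hB h.xx h.yy hl₂]; exact hxp
    have hu'p : B u' p = 0 := by
      simp only [hu'def, map_sub, map_smul, LinearMap.sub_apply, LinearMap.smul_apply,
        smul_eq_mul, hz₁p, hxp, hyp, mul_zero, sub_zero]
    have hv'p : B v' p = 0 := by
      simp only [hv'def, map_sub, map_smul, LinearMap.sub_apply, LinearMap.smul_apply,
        smul_eq_mul, hx₂p, hxp, hyp, mul_zero, sub_zero]
    refine UGen.eval_apply_eq_self B x y hxp hyp fun g hg => ?_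
    simp only [List.mem_append, List.mem_cons, List.not_mem_nil, or_false] at hg
    rcases hg with hg | (rfl | rfl | rfl) | hg
    · exact UGen.arg_ortho_of_mem_invWord hl₂p hg
    · rw [UGen.arg_atY, map_neg, LinearMap.neg_apply, hv'p, neg_zero]
    · rw [UGen.arg_atX, map_sub, LinearMap.sub_apply, hu₁p, hv₁p, sub_zero]
    · rw [UGen.arg_atY, hu'p]
    · exact hl₁p g hg

end Transitive

/-! ### Frame transport by words in the transvections of the target planes -/

section Frames

variable (B) in
/-- The admissible transvections `E(y_j, a, q)`, `E(x_j, a, q)` of the planes `(x_j, y_j)_j`, as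
a set of isometries described pointwise (so that `IsWordIn (planeGens B xs ys)` does not depend on
the proofs bundled in `UGen.toIsometryEquiv`). [cite: GritsenkoHulekSankaran2009, §3.3] -/
def planeGens {K : ℕ} (xs ys : Fin K → W) : Set (B.IsometryEquiv B) :=
  {ψ | ∃ (j : Fin K) (g : UGen W), g.IsAdmissible B (xs j) (ys j) ∧
    ∀ v, ψ v = g.toLinearMap B (xs j) (ys j) v}

/-- An admissible word of the plane `(x_j, y_j)` is a word in `planeGens`. [folklore] -/
theorem isWordIn_planeGens_evalEquiv (hB : B.IsSymm) {K : ℕ} {xs ys : Fin K → W} (j : Fin K)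
    (hxx : B (xs j) (xs j) = 0) (hyy : B (ys j) (ys j) = 0) (l : List (UGen W))
    (hl : ∀ g ∈ l, g.IsAdmissible B (xs j) (ys j)) :
    IsWordIn (planeGens B xs ys) (UGen.evalEquiv hB hxx hyy l hl) := by
  induction l with
  | nil => exact IsWordIn.refl.congr fun v => by simp [UGen.evalEquiv_apply]
  | cons g l ih =>
    have hg : g.IsAdmissible B (xs j) (ys j) := hl g List.mem_cons_self
    have h₁ := ih fun g' hg' => hl g' (List.mem_cons_of_mem g hg')
    have h₂ : IsWordIn (planeGens B xs ys) (UGen.toIsometryEquiv hB hxx hyy g hg) :=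
      IsWordIn.of_mem ⟨j, g, hg, fun v => UGen.toIsometryEquiv_apply hB hxx hyy g hg v⟩
    exact (h₁.trans h₂).congr fun v => by
      simp [UGen.evalEquiv_apply, UGen.eval_cons, LinearMap.BilinForm.IsometryEquiv.trans_apply]

/-- **Frame transport** (the algebra behind Wall 1964, p. 145 "for some automorph `T` of
`H₂(∂V)`, `T(L) = K`", for the subgroup generated by Eichler transvections). Let
`(x_j, y_j)_{j < K}` be pairwise orthogonal hyperbolic pairs of a symmetric integral bilinear
module and `(x₀, y₀)` one more hyperbolic pair orthogonal to all of them. Then the isotropic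
half `u` of every hyperbolic `K`-frame `(u, u')` (`u_i·u_j = 0`, `u'_i·u'_j = 0`,
`u_i·u'_j = δ_{ij}`) is carried ONTO `(y_j)_j` — `φ (u i) = y i` for all `i` — by a word `φ` in
the admissible transvections of the planes `(x_j, y_j)`. Proof: induction on `j`; having placed
`u_i` at `y_i` for `i < j`, the current images `w, z` of `u_j, u'_j` are an isotropic vector with
an isotropic dual, orthogonal to the `y_i`, `i < j`, and the word of
`exists_uGens_apply_eq_fixing` for the pairs `(x_j, y_j)`, `(x₀, y₀)` carries `w` to `y_j`
fixing those `y_i`. [cite: WallJLMS1964, §2, p. 145]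
[cite: GritsenkoHulekSankaran2009, Prop. 3.3 (i)] -/
theorem exists_isWordIn_planeGens_apply_eq (hB : B.IsSymm) {K : ℕ} {xs ys : Fin K → W}
    {x₀ y₀ : W} (hxx : ∀ i j, B (xs i) (xs j) = 0) (hyy : ∀ i j, B (ys i) (ys j) = 0)
    (hxy : ∀ i j, B (xs i) (ys j) = if i = j then 1 else 0)
    (hx₀x₀ : B x₀ x₀ = 0) (hy₀y₀ : B y₀ y₀ = 0) (hx₀y₀ : B x₀ y₀ = 1)
    (hxx₀ : ∀ j, B (xs j) x₀ = 0) (hxy₀ : ∀ j, B (xs j) y₀ = 0) (hyx₀ : ∀ j, B (ys j) x₀ = 0)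
    (hyy₀ : ∀ j, B (ys j) y₀ = 0) (u u' : Fin K → W) (hu : ∀ i j, B (u i) (u j) = 0)
    (hu' : ∀ i j, B (u' i) (u' j) = 0) (huu' : ∀ i j, B (u i) (u' j) = if i = j then 1 else 0) :
    ∃ φ : B.IsometryEquiv B, IsWordIn (planeGens B xs ys) φ ∧ ∀ i, φ (u i) = ys i := by
  -- induction on the number `n` of vectors already placed
  suffices H : ∀ n ≤ K, ∃ φ : B.IsometryEquiv B, IsWordIn (planeGens B xs ys) φ ∧
      ∀ i : Fin K, i.val < n → φ (u i) = ys i by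
    obtain ⟨φ, hφ, h⟩ := H K le_rfl
    exact ⟨φ, hφ, fun i => h i i.isLt⟩
  intro n
  induction n with
  | zero => exact fun _ => ⟨LinearMap.BilinForm.IsometryEquiv.refl B, IsWordIn.refl,
      fun i hi => absurd hi (Nat.not_lt_zero _)⟩
  | succ n ih =>
    intro hn
    obtain ⟨φ, hφ, hφu⟩ := ih (Nat.le_of_succ_le hn)
    set j : Fin K := ⟨n, hn⟩ with hjdef
    -- the pairs `(x_j, y_j)`, `(x₀, y₀)`
    have hpair : TwoHyperbolicPairs B (xs j) (ys j) x₀ y₀ :=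
      { isSymm := hB
        xx := hxx j j
        yy := hyy j j
        xy := by rw [hxy, if_pos rfl]
        x₁x₁ := hx₀x₀
        y₁y₁ := hy₀y₀
        x₁y₁ := hx₀y₀
        xx₁ := hxx₀ j
        xy₁ := hxy₀ j
        yx₁ := hyx₀ j
        yy₁ := hyy₀ j }
    -- the current images of `u_j`, `u'_j`
    have hw : B (φ (u j)) (φ (u j)) = 0 := by rw [φ.map_app, hu]
    have hwz : B (φ (u j)) (φ (u' j)) = 1 := by rw [φ.map_app, huu', if_pos rfl]
    have hz : B (φ (u' j)) (φ (u' j)) = 0 + 0 := by rw [φ.map_app, hu', add_zero]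
    obtain ⟨l, hl, hlw, hfix⟩ := exists_uGens_apply_eq_fixing hpair hw hwz hz
    refine ⟨φ.trans (UGen.evalEquiv hB (hxx j j) (hyy j j) l hl),
      hφ.trans (isWordIn_planeGens_evalEquiv hB j (hxx j j) (hyy j j) l hl), fun i hi => ?_⟩
    rw [LinearMap.BilinForm.IsometryEquiv.trans_apply, UGen.evalEquiv_apply]
    rcases Nat.lt_succ_iff_lt_or_eq.1 hi with hi | hi
    · -- `i < n`: `φ (u i) = y i` is fixed by the new word
      have hij : i ≠ j := fun hij => by
        rw [hij] at hi
        exact lt_irrefl _ hi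
      have hji : j ≠ i := fun h => hij h.symm
      rw [hφu i hi]
      refine hfix (ys i) ?_ ?_ ?_ ?_ ?_ ?_
      · rw [hxy, if_neg hji]
      · exact hyy j i
      · rw [hB.eq, hyx₀]
      · rw [hB.eq, hyy₀]
      · rw [← hφu i hi, φ.map_app, hu]
      · rw [← hφu i hi, φ.map_app, hB.eq, huu', if_neg hij]
    · -- `i = j`
      have hij : i = j := Fin.ext hi
      rw [hij, hlw]

end Frames

/-! ### In `Q ⊕ H`: transvections of any plane are words in Kirby's generators (GHS 3.3 (ii)) -/

section Prod

variable {V : Type*} [AddCommGroup V] {Q : BilinForm ℤ V}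

/-- Local notation for the form `Q ⊕ H` on `V × (Fin 2 → ℤ)`. -/
local notation "QH" => (Q.prod hyperbolicForm)

/-- Changing the argument of `E(e, a, q)` by a multiple of `e` does not change the transvection
(GHS (t5): `t(e, xe) = id`, with (t3); here for the parametrised `E(e, a, q)`, no isotropy needed). [cite: GritsenkoHulekSankaran2009, §3.1 (t3), (t5)] -/
theorem eichlerTransvection_sub_smul_self {M : Type*} [AddCommGroup M] (C : BilinForm ℤ M)
    (e a : M) (t q : ℤ) :
    C.eichlerTransvection e (a - t • e) q = C.eichlerTransvection e a q := by
  ext v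
  simp only [LinearMap.BilinForm.eichlerTransvection_apply, map_sub, map_smul,
    LinearMap.sub_apply, LinearMap.smul_apply, smul_eq_mul]
  module

/-- **A transvection `E(e', a, q)` based at ANY isotropic `e'` with an isotropic dual is a word in
Kirby's generators of `O(Q ⊕ H)`** (GHS Prop. 3.3 (ii) "`E(L) = E_U(L₁)`" in Kirby's coordinates,
given a hyperbolic pair `(x₀, y₀)` orthogonal to `H` to run the Eichler criterion): with `σ` the
admissible word of the `H`-plane carrying `e'` to `y = (0, (0,1))`
(`exists_uGens_apply_eq_fixing`), `E(e', a, q) = σ⁻¹ E(y, σ a, q) σ` (naturality,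
`IsometryEquiv.map_eichlerTransvection_apply`), and `E(y, σ a, q) = E(y, σ a - (x·σa) y, q)` is a
generator `A_b`. [cite: GritsenkoHulekSankaran2009, Prop. 3.3 (ii) (proof, p. 469)]
[cite: Kirby1989, Ch. X, proof of Thm. 2 (p. 62)] -/
theorem isWordIn_wallGenerators_of_eichlerTransvection (hQ : Q.IsSymm) {x₀ y₀ : V × (Fin 2 → ℤ)}
    (h₀ : TwoHyperbolicPairs QH hypX hypY x₀ y₀) {e' f' a : V × (Fin 2 → ℤ)} {q : ℤ}
    (he' : QH e' e' = 0) (hf' : QH f' f' = 0) (he'f' : QH e' f' = 1) (he'a : QH e' a = 0)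
    (hq : QH a a = q + q) (ψ : (QH).IsometryEquiv QH)
    (hψ : ∀ v, ψ v = (QH).eichlerTransvection e' a q v) :
    IsWordIn (wallGenerators hQ) ψ := by
  have hB : (QH).IsSymm := h₀.isSymm
  -- `σ`: the word of the `H`-plane carrying `e'` to `y`
  obtain ⟨l, hl, hle', -⟩ := exists_uGens_apply_eq_fixing h₀ he' he'f' (qz := 0)
    (by rw [hf', add_zero])
  set σ := UGen.evalEquiv hB h₀.xx h₀.yy l hl with hσdef
  have hσe' : σ e' = hypY := by rw [hσdef, UGen.evalEquiv_apply, hle']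
  have hσ : IsWordIn (wallGenerators hQ) σ := isWordIn_evalEquiv hQ hB h₀.xx h₀.yy l hl
  -- the generator `E(y, b, q)`, `b = σ a - (x·σa) y`
  set b : V × (Fin 2 → ℤ) := σ a - (QH hypX (σ a)) • hypY with hbdef
  have hyσa : QH hypY (σ a) = 0 := by rw [← hσe', σ.map_app, he'a]
  have hb : (UGen.atY b q : UGen (V × (Fin 2 → ℤ))).IsAdmissible QH hypX hypY := by
    refine ⟨?_, ?_, ?_⟩
    · simp only [hbdef, map_sub, map_smul, smul_eq_mul, h₀.xy, mul_one, sub_self]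
    · simp only [hbdef, map_sub, map_smul, smul_eq_mul, h₀.yy, mul_zero, sub_zero, hyσa]
    · have hσaσa : QH (σ a) (σ a) = q + q := by rw [σ.map_app, hq]
      have hσay : QH (σ a) hypY = 0 := by rw [hB.eq, hyσa]
      simp only [hbdef, map_sub, map_smul, LinearMap.sub_apply, LinearMap.smul_apply,
        smul_eq_mul, hσaσa, hσay, hyσa, h₀.yy, mul_zero, sub_zero]
  have hgen : IsWordIn (wallGenerators hQ) (UGen.toIsometryEquiv hB h₀.xx h₀.yy _ hb) :=
    IsWordIn.of_mem (UGen.toIsometryEquiv_mem_wallGenerators hQ hB h₀.xx h₀.yy _ hb)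
  -- `ψ = σ E(y, b, q) σ⁻¹`
  refine ((hσ.trans hgen).trans hσ.symm).congr fun v => ?_
  rw [LinearMap.BilinForm.IsometryEquiv.trans_apply, LinearMap.BilinForm.IsometryEquiv.trans_apply,
    UGen.toIsometryEquiv_apply, hψ]
  change σ.symm ((QH).eichlerTransvection hypY b q (σ v)) = _
  rw [hbdef, eichlerTransvection_sub_smul_self QH, ← hσe',
    ← LinearMap.BilinForm.IsometryEquiv.map_eichlerTransvection_apply σ e' a q v,
    LinearMap.BilinForm.IsometryEquiv.symm_apply_apply]

/-- **The admissible transvections of every hyperbolic plane `(x_j, y_j)` of `Q ⊕ H` are words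
in Kirby's generators** (given a hyperbolic pair `(x₀, y₀) ⊥ H`): `planeGens ⊆ ⟨wallGenerators⟩`.
[cite: GritsenkoHulekSankaran2009, Prop. 3.3 (ii)] [cite: Kirby1989, Ch. X, proof of Thm. 2 (p. 62)] -/
theorem isWordIn_wallGenerators_of_mem_planeGens (hQ : Q.IsSymm) {x₀ y₀ : V × (Fin 2 → ℤ)}
    (h₀ : TwoHyperbolicPairs QH hypX hypY x₀ y₀) {K : ℕ} {xs ys : Fin K → V × (Fin 2 → ℤ)}
    (hxx : ∀ j, QH (xs j) (xs j) = 0) (hyy : ∀ j, QH (ys j) (ys j) = 0)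
    (hxy : ∀ j, QH (xs j) (ys j) = 1) {ψ : (QH).IsometryEquiv QH}
    (hψ : ψ ∈ planeGens QH xs ys) : IsWordIn (wallGenerators hQ) ψ := by
  have hB : (QH).IsSymm := h₀.isSymm
  obtain ⟨j, g, hg, hψg⟩ := hψ
  cases g with
  | atY a q =>
    obtain ⟨-, hya, hq⟩ := hg
    exact isWordIn_wallGenerators_of_eichlerTransvection hQ h₀ (hyy j) (hxx j)
      (by rw [hB.eq, hxy]) hya hq ψ hψg
  | atX a q =>
    obtain ⟨hxa, -, hq⟩ := hg
    exact isWordIn_wallGenerators_of_eichlerTransvection hQ h₀ (hxx j) (hyy j) (hxy j) hxa hq ψ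
      hψg

/-- **What the regluing consumes, from one-summand generators** (Kirby 1989, p. 56 "we need a
diffeomorphism `g` … which on homology satisfies `(gd)_* = φ ⊕ ψ`"; Wall 1964, p. 145). In
`Q ⊕ H`, let `(x_j, y_j)_{j < K}` be pairwise orthogonal hyperbolic pairs and `(x₀, y₀)` a
hyperbolic pair orthogonal to all of them and to `H` (in the application: the planes of the other
`S² × S²` summands together with `H` itself, and a hyperbolic pair of the core `Q_M`). Then for
every isometry `A` of `Q ⊕ H` and every hyperbolic `K`-frame `(u, u')` there is a word `φ` in
Kirby's generators `wallGenerators` (the transvections `A_a`, `A'_a` of the `H`-summand and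
`1 ⊕ O(H)`) with `φ (u i) = A (u i)` for all `i`: transport `u` and `A u` onto `(y_j)_j`
(`exists_isWordIn_planeGens_apply_eq`) and compose; the transvections of the planes `(x_j, y_j)`
are words in the generators (`isWordIn_wallGenerators_of_mem_planeGens`). No generation theorem
for `O(Q ⊕ H)` is used. [cite: Kirby1989, Ch. X, proof of Thm. 1 (p. 56)]
[cite: WallJLMS1964, §2, p. 145] [cite: GritsenkoHulekSankaran2009, Prop. 3.3 (i), (ii)] -/
theorem exists_isWordIn_wallGenerators_apply_eq_of_frame (hQ : Q.IsSymm) {K : ℕ}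
    {xs ys : Fin K → V × (Fin 2 → ℤ)} {x₀ y₀ : V × (Fin 2 → ℤ)}
    (h₀ : TwoHyperbolicPairs QH hypX hypY x₀ y₀)
    (hxx : ∀ i j, QH (xs i) (xs j) = 0) (hyy : ∀ i j, QH (ys i) (ys j) = 0)
    (hxy : ∀ i j, QH (xs i) (ys j) = if i = j then 1 else 0)
    (hxx₀ : ∀ j, QH (xs j) x₀ = 0) (hxy₀ : ∀ j, QH (xs j) y₀ = 0) (hyx₀ : ∀ j, QH (ys j) x₀ = 0)
    (hyy₀ : ∀ j, QH (ys j) y₀ = 0) (A : (QH).IsometryEquiv QH) (u u' : Fin K → V × (Fin 2 → ℤ))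
    (hu : ∀ i j, QH (u i) (u j) = 0) (hu' : ∀ i j, QH (u' i) (u' j) = 0)
    (huu' : ∀ i j, QH (u i) (u' j) = if i = j then 1 else 0) :
    ∃ φ : (QH).IsometryEquiv QH, IsWordIn (wallGenerators hQ) φ ∧ ∀ i, φ (u i) = A (u i) := by
  have hB : (QH).IsSymm := h₀.isSymm
  have hgens : ∀ ψ ∈ planeGens QH xs ys, IsWordIn (wallGenerators hQ) ψ := fun ψ hψ =>
    isWordIn_wallGenerators_of_mem_planeGens hQ h₀ (fun j => hxx j j) (fun j => hyy j j)
      (fun j => by rw [hxy, if_pos rfl]) hψ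
  -- transport `u` and `A u` onto `(y_j)_j`
  obtain ⟨φ₁, hφ₁, hφ₁u⟩ := exists_isWordIn_planeGens_apply_eq hB hxx hyy hxy h₀.x₁x₁ h₀.y₁y₁
    h₀.x₁y₁ hxx₀ hxy₀ hyx₀ hyy₀ u u' hu hu' huu'
  obtain ⟨φ₂, hφ₂, hφ₂u⟩ := exists_isWordIn_planeGens_apply_eq hB hxx hyy hxy h₀.x₁x₁ h₀.y₁y₁
    h₀.x₁y₁ hxx₀ hxy₀ hyx₀ hyy₀ (fun i => A (u i)) (fun i => A (u' i))
    (fun i j => by rw [A.map_app, hu]) (fun i j => by rw [A.map_app, hu'])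
    (fun i j => by rw [A.map_app, huu'])
  refine ⟨φ₁.trans φ₂.symm, (hφ₁.bind hgens).trans (hφ₂.bind hgens).symm, fun i => ?_⟩
  rw [LinearMap.BilinForm.IsometryEquiv.trans_apply, hφ₁u, ← hφ₂u i,
    LinearMap.BilinForm.IsometryEquiv.symm_apply_apply]

end Prod

/-! ### Full frames: the endgame with `1 ⊕ O(H)` (no spare plane) -/

section FullFrame

variable {V : Type*} [AddCommGroup V] {Q : BilinForm ℤ V}

/-- Local notation for the form `Q ⊕ H` on `V × (Fin 2 → ℤ)`. -/
local notation "QH" => (Q.prod hyperbolicForm)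

/-- A vector of `Q ⊕ H` orthogonal to `x` and `y` lies in the summand `Q`. [folklore] -/
theorem eq_inl_fst_of_ortho_hyp {v : V × (Fin 2 → ℤ)} (hX : QH v hypX = 0) (hY : QH v hypY = 0) :
    v = (v.1, 0) := by
  rw [prod_hyperbolic_apply_hypX] at hX
  rw [prod_hyperbolic_apply_hypY] at hY
  refine Prod.ext rfl (funext fun i => ?_)
  fin_cases i
  · exact hY
  · exact hX

/-- **The endgame of the full-frame transport** (the step Kirby's `1 ⊕ O(H)` is for): in `Q ⊕ H`,
let `(y_j)_{j<K}` be vectors orthogonal to `H`, and `s` a vector orthogonal to all of them, to `H`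
and to itself (in the application `s = Σ a_i y_i` for pairwise orthogonal isotropic `y_j`).  The
vector `w = s + α x + β y` with `(α, β) ∈ {(0, ±1), (±1, 0)}` is carried to `y` by a word in
Kirby's generators fixing every `y_j`: the swap and `−1` of `H` (`1 ⊕ O(H)`) normalise `(α, β)` to
`(0, 1)`, and the transvection `A'_a = E(x, a, 0)`, `a = −s`, removes `s`.
[cite: Kirby1989, Ch. X, proof of Thm. 2 (pp. 61–62)] [cite: WallJLMS1964, §2, p. 145] -/
theorem exists_isWordIn_wallGenerators_endgame (hQ : Q.IsSymm) {K : ℕ}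
    {ys : Fin K → V × (Fin 2 → ℤ)} (hyX : ∀ j, QH (ys j) hypX = 0) (hyY : ∀ j, QH (ys j) hypY = 0)
    {s : V × (Fin 2 → ℤ)} (hsy : ∀ j, QH s (ys j) = 0) (hsX : QH s hypX = 0) (hsY : QH s hypY = 0)
    (hss : QH s s = 0) (α β : ℤ) (hαβ : (α = 0 ∧ (β = 1 ∨ β = -1)) ∨ (β = 0 ∧ (α = 1 ∨ α = -1))) :
    ∃ η : (QH).IsometryEquiv QH, IsWordIn (wallGenerators hQ) η ∧ (∀ j, η (ys j) = ys j) ∧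
      η (s + α • hypX + β • hypY) = hypY := by
  have hB : (QH).IsSymm := hQ.prod isSymm_hyperbolicForm
  have hys : ∀ j, ys j = ((ys j).1, 0) := fun j => eq_inl_fst_of_ortho_hyp (hyX j) (hyY j)
  have hs : s = (s.1, 0) := eq_inl_fst_of_ortho_hyp hsX hsY
  -- the transvection `A'_{aV}`, `(aV, 0) = -s`
  set aV : V := -s.1 with haV
  have haQ : ((aV, 0) : V × (Fin 2 → ℤ)) = -s := by
    rw [hs, haV, Prod.neg_mk, neg_zero]
  have haa : Q aV aV = 0 + 0 := by
    have hneg : QH (-s) (-s) = QH s s := by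
      rw [map_neg, map_neg, LinearMap.neg_apply, neg_neg]
    rw [add_zero, ← prod_hyperbolic_inl_inl (Q := Q), haQ, hneg, hss]
  set T := transvectionA'Equiv hQ aV 0 haa with hTdef
  have hT : IsWordIn (wallGenerators hQ) T :=
    IsWordIn.of_mem (transvectionA'Equiv_mem_wallGenerators hQ aV 0 haa)
  have hTapply : ∀ v, T v = v + QH hypX v • ((aV, 0) : V × (Fin 2 → ℤ)) -
      QH ((aV, 0) : V × (Fin 2 → ℤ)) v • hypX := fun v => by
    rw [hTdef, transvectionA'Equiv_apply]
    change (QH).eichlerTransvection hypX (aV, 0) 0 v = _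
    rw [LinearMap.BilinForm.eichlerTransvection_apply, zero_mul, zero_smul, sub_zero]
  have hTy : ∀ j, T (ys j) = ys j := fun j => by
    rw [hTapply, hB.eq, hyX, zero_smul, add_zero, haQ, map_neg, LinearMap.neg_apply, hsy, neg_zero,
      zero_smul, sub_zero]
  have hTw : T (s + hypY) = hypY := by
    rw [hTapply, map_add, map_add, hB.eq hypX s, hsX, prod_hyperbolic_hypX_hypY, zero_add, one_smul,
      haQ, map_neg, LinearMap.neg_apply, LinearMap.neg_apply, hss, hsY, neg_zero, add_zero,
      zero_smul, sub_zero, add_neg_cancel_comm]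
  -- the swap and `-1` of `H`
  set S := (LinearMap.BilinForm.IsometryEquiv.refl Q).prodCongr hyperbolicSwap with hSdef
  set N := (LinearMap.BilinForm.IsometryEquiv.refl Q).prodCongr
    (LinearMap.BilinForm.IsometryEquiv.neg hyperbolicForm) with hNdef
  have hS : IsWordIn (wallGenerators hQ) S := IsWordIn.of_mem (prodCongr_refl_mem_wallGenerators hQ _)
  have hN : IsWordIn (wallGenerators hQ) N := IsWordIn.of_mem (prodCongr_refl_mem_wallGenerators hQ _)
  have hS0 : ∀ v : V, S ((v, 0) : V × (Fin 2 → ℤ)) = (v, 0) := fun v => by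
    rw [hSdef, LinearMap.BilinForm.IsometryEquiv.prodCongr_apply]
    refine Prod.ext rfl ?_
    change (![(0 : Fin 2 → ℤ) 1, (0 : Fin 2 → ℤ) 0] : Fin 2 → ℤ) = 0
    ext i; fin_cases i <;> rfl
  have hN0 : ∀ v : V, N ((v, 0) : V × (Fin 2 → ℤ)) = (v, 0) := fun v => by
    rw [hNdef, LinearMap.BilinForm.IsometryEquiv.prodCongr_apply]
    refine Prod.ext rfl ?_
    change -(0 : Fin 2 → ℤ) = 0
    exact neg_zero
  have hSy : ∀ j, S (ys j) = ys j := fun j => by rw [hys j, hS0]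
  have hNy : ∀ j, N (ys j) = ys j := fun j => by rw [hys j, hN0]
  have hSs : S s = s := by rw [hs, hS0]
  have hNs : N s = s := by rw [hs, hN0]
  have hSX : S hypX = hypY := by
    rw [hSdef, LinearMap.BilinForm.IsometryEquiv.prodCongr_apply]
    refine Prod.ext rfl ?_
    change (![(Pi.single 0 1 : Fin 2 → ℤ) 1, (Pi.single 0 1 : Fin 2 → ℤ) 0] : Fin 2 → ℤ) =
      Pi.single 1 1
    ext i; fin_cases i <;> simp
  have hNY : N hypY = -hypY := by
    rw [hNdef, LinearMap.BilinForm.IsometryEquiv.prodCongr_apply]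
    refine Prod.ext (neg_zero).symm ?_
    rfl
  rcases hαβ with ⟨rfl, rfl | rfl⟩ | ⟨rfl, rfl | rfl⟩
  · -- `(0, 1)`
    refine ⟨T, hT, hTy, ?_⟩
    rw [zero_smul, add_zero, one_smul, hTw]
  · -- `(0, -1)`: `N` then `T`
    refine ⟨N.trans T, hN.trans hT, fun j => by
      rw [LinearMap.BilinForm.IsometryEquiv.trans_apply, hNy, hTy], ?_⟩
    rw [LinearMap.BilinForm.IsometryEquiv.trans_apply, zero_smul, add_zero, neg_one_smul, map_add,
      map_neg, hNs, hNY, neg_neg, hTw]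
  · -- `(1, 0)`: `S` then `T`
    refine ⟨S.trans T, hS.trans hT, fun j => by
      rw [LinearMap.BilinForm.IsometryEquiv.trans_apply, hSy, hTy], ?_⟩
    rw [LinearMap.BilinForm.IsometryEquiv.trans_apply, one_smul, zero_smul, add_zero, map_add, hSs,
      hSX, hTw]
  · -- `(-1, 0)`: `S`, `N`, then `T`
    refine ⟨(S.trans N).trans T, (hS.trans hN).trans hT, fun j => by
      rw [LinearMap.BilinForm.IsometryEquiv.trans_apply, LinearMap.BilinForm.IsometryEquiv.trans_apply,
        hSy, hNy, hTy], ?_⟩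
    rw [LinearMap.BilinForm.IsometryEquiv.trans_apply, LinearMap.BilinForm.IsometryEquiv.trans_apply,
      neg_one_smul, zero_smul, add_zero, map_add, map_neg, hSs, hSX, map_add, map_neg, hNs, hNY,
      neg_neg, hTw]

/-- **Transport of a FULL hyperbolic frame onto the standard one by words in Kirby's generators**
(the case of `exists_isWordIn_wallGenerators_apply_eq_of_frame` without a spare plane).  In
`Q ⊕ H` let `(x_j, y_j)_{j<K}` be pairwise orthogonal hyperbolic pairs inside the summand `Q`
(orthogonal to `H`) which together with `H` exhaust the lattice (`hspan`: a vector orthogonal to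
all `x_j, y_j` and to `x, y` vanishes) — e.g. `Q ≅ K·H` with its planes.  Then the isotropic half
`u` of every hyperbolic `(K+1)`-frame `(u, u')` is carried onto `(y_0, …, y_{K-1}, y)` by a word in
`wallGenerators`: the first `K` vectors by the frame transport of the target planes with `H` as
the auxiliary pair (`exists_isWordIn_planeGens_apply_eq`; its transvections are words in the
generators, `isWordIn_wallGenerators_of_mem_planeGens`, the auxiliary pair for that conjugation
being `(x_0, y_0)`), after which the last vector `w` — isotropic, orthogonal to the placed `y_i`,
with an isotropic dual `z` of the same kind — is `Σ a_i y_i + α x + β y` with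
`(α, β) ∈ {(0, ±1), (±1, 0)}` (`hspan`, `w·w = 0`, `w·z = 1`), and the endgame
(`exists_isWordIn_wallGenerators_endgame`: `1 ⊕ O(H)` and one `A'_a`) finishes.
[cite: Kirby1989, Ch. X, proof of Thm. 2 (pp. 61–62)] [cite: WallJLMS1964, §2, p. 145]
[cite: GritsenkoHulekSankaran2009, Prop. 3.3 (i), (ii)] -/
theorem exists_isWordIn_wallGenerators_apply_eq_std_of_fullFrame (hQ : Q.IsSymm) {K : ℕ}
    {xs ys : Fin K → V × (Fin 2 → ℤ)}
    (hxx : ∀ i j, QH (xs i) (xs j) = 0) (hyy : ∀ i j, QH (ys i) (ys j) = 0)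
    (hxy : ∀ i j, QH (xs i) (ys j) = if i = j then 1 else 0)
    (hxX : ∀ j, QH (xs j) hypX = 0) (hxY : ∀ j, QH (xs j) hypY = 0)
    (hyX : ∀ j, QH (ys j) hypX = 0) (hyY : ∀ j, QH (ys j) hypY = 0)
    (hspan : ∀ v : V × (Fin 2 → ℤ), (∀ j, QH v (xs j) = 0) → (∀ j, QH v (ys j) = 0) →
      QH v hypX = 0 → QH v hypY = 0 → v = 0)
    (u u' : Fin (K + 1) → V × (Fin 2 → ℤ))
    (hu : ∀ i j, QH (u i) (u j) = 0) (hu' : ∀ i j, QH (u' i) (u' j) = 0)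
    (huu' : ∀ i j, QH (u i) (u' j) = if i = j then 1 else 0) :
    ∃ φ : (QH).IsometryEquiv QH, IsWordIn (wallGenerators hQ) φ ∧
      (∀ i : Fin K, φ (u (Fin.castSucc i)) = ys i) ∧ φ (u (Fin.last K)) = hypY := by
  have hB : (QH).IsSymm := hQ.prod isSymm_hyperbolicForm
  -- the transvections of the target planes are words in the generators
  have hgens : ∀ ψ ∈ planeGens QH xs ys, IsWordIn (wallGenerators hQ) ψ := by
    intro ψ hψ
    cases K with
    | zero =>
      obtain ⟨j, -⟩ := hψ
      exact j.elim0
    | succ K =>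
      have h₀ : TwoHyperbolicPairs QH hypX hypY (xs 0) (ys 0) :=
        { isSymm := hB
          xx := prod_hyperbolic_hypX_hypX Q
          yy := prod_hyperbolic_hypY_hypY Q
          xy := prod_hyperbolic_hypX_hypY Q
          x₁x₁ := hxx 0 0
          y₁y₁ := hyy 0 0
          x₁y₁ := by rw [hxy, if_pos rfl]
          xx₁ := by rw [hB.eq, hxX]
          xy₁ := by rw [hB.eq, hyX]
          yx₁ := by rw [hB.eq, hxY]
          yy₁ := by rw [hB.eq, hyY] }
      exact isWordIn_wallGenerators_of_mem_planeGens hQ h₀ (fun j => hxx j j) (fun j => hyy j j)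
        (fun j => by rw [hxy, if_pos rfl]) hψ
  -- place the first `K` vectors, `H` being the auxiliary pair
  obtain ⟨φ, hφ, hφu⟩ := exists_isWordIn_planeGens_apply_eq hB hxx hyy hxy
    (prod_hyperbolic_hypX_hypX Q) (prod_hyperbolic_hypY_hypY Q) (prod_hyperbolic_hypX_hypY Q)
    hxX hxY hyX hyY (fun i => u (Fin.castSucc i)) (fun i => u' (Fin.castSucc i))
    (fun i j => hu _ _) (fun i j => hu' _ _)
    (fun i j => by simp only [huu', Fin.castSucc_inj])
  -- sums along the `y_i` are orthogonal to the `y_j`, to `H`, and to every `v ⊥ (y_i)_i`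
  have hSy : ∀ (c : Fin K → ℤ) j, QH (∑ i, c i • ys i) (ys j) = 0 := fun c j => by
    rw [LinearMap.BilinForm.sum_left]
    exact Finset.sum_eq_zero fun i _ => by rw [LinearMap.BilinForm.smul_left, hyy, mul_zero]
  have hSX : ∀ c : Fin K → ℤ, QH (∑ i, c i • ys i) hypX = 0 := fun c => by
    rw [LinearMap.BilinForm.sum_left]
    exact Finset.sum_eq_zero fun i _ => by rw [LinearMap.BilinForm.smul_left, hyX, mul_zero]
  have hSY : ∀ c : Fin K → ℤ, QH (∑ i, c i • ys i) hypY = 0 := fun c => by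
    rw [LinearMap.BilinForm.sum_left]
    exact Finset.sum_eq_zero fun i _ => by rw [LinearMap.BilinForm.smul_left, hyY, mul_zero]
  have hSv : ∀ (c : Fin K → ℤ) (v : V × (Fin 2 → ℤ)), (∀ i, QH v (ys i) = 0) →
      QH (∑ i, c i • ys i) v = 0 := fun c v hv => by
    rw [LinearMap.BilinForm.sum_left]
    exact Finset.sum_eq_zero fun i _ => by
      rw [LinearMap.BilinForm.smul_left, hB.eq, hv, mul_zero]
  have hSx : ∀ (c : Fin K → ℤ) j, QH (∑ i, c i • ys i) (xs j) = c j := fun c j => by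
    rw [LinearMap.BilinForm.sum_left, Finset.sum_eq_single j]
    · rw [LinearMap.BilinForm.smul_left, hB.eq, hxy, if_pos rfl, mul_one]
    · intro i _ hij
      rw [LinearMap.BilinForm.smul_left, hB.eq, hxy, if_neg (Ne.symm hij), mul_zero]
    · intro h; exact absurd (Finset.mem_univ j) h
  -- expansion of a vector orthogonal to the `y_i`
  have hexp : ∀ v : V × (Fin 2 → ℤ), (∀ i, QH v (ys i) = 0) →
      v = ∑ i, QH v (xs i) • ys i + QH v hypY • hypX + QH v hypX • hypY := by
    intro v hv
    rw [← sub_eq_zero]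
    refine hspan _ (fun j => ?_) (fun j => ?_) ?_ ?_
    · rw [map_sub, map_add, map_add, LinearMap.sub_apply, LinearMap.add_apply, LinearMap.add_apply,
        hSx, LinearMap.BilinForm.smul_left, LinearMap.BilinForm.smul_left, hB.eq hypX, hxX,
        hB.eq hypY, hxY, mul_zero, mul_zero, add_zero, add_zero, sub_self]
    · rw [map_sub, map_add, map_add, LinearMap.sub_apply, LinearMap.add_apply, LinearMap.add_apply,
        hSy, hv, LinearMap.BilinForm.smul_left, LinearMap.BilinForm.smul_left, hB.eq hypX, hyX,
        hB.eq hypY, hyY, mul_zero, mul_zero, add_zero, add_zero, sub_self]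
    · rw [map_sub, map_add, map_add, LinearMap.sub_apply, LinearMap.add_apply, LinearMap.add_apply,
        hSX, LinearMap.BilinForm.smul_left, LinearMap.BilinForm.smul_left, prod_hyperbolic_hypX_hypX,
        prod_hyperbolic_hypY_hypX, mul_zero, mul_one, zero_add, zero_add, sub_self]
    · rw [map_sub, map_add, map_add, LinearMap.sub_apply, LinearMap.add_apply, LinearMap.add_apply,
        hSY, LinearMap.BilinForm.smul_left, LinearMap.BilinForm.smul_left, prod_hyperbolic_hypX_hypY,
        prod_hyperbolic_hypY_hypY, mul_zero, mul_one, zero_add, add_zero, sub_self]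
  -- the last vector `w`, its dual `z`, and the coefficients `α = w·y`, `β = w·x`
  set w := φ (u (Fin.last K)) with hwdef
  set z := φ (u' (Fin.last K)) with hzdef
  have hne : ∀ i : Fin K, Fin.castSucc i ≠ Fin.last K := fun i => (Fin.castSucc_lt_last i).ne
  have hwy : ∀ i, QH w (ys i) = 0 := fun i => by
    rw [hwdef, ← hφu i, φ.map_app, hu]
  have hzy : ∀ i, QH z (ys i) = 0 := fun i => by
    rw [hzdef, ← hφu i, φ.map_app, hB.eq, huu', if_neg (hne i)]
  have hww : QH w w = 0 := by rw [hwdef, φ.map_app, hu]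
  have hzw : QH z w = 1 := by rw [hwdef, hzdef, φ.map_app, hB.eq, huu', if_pos rfl]
  have hw : w = ∑ i, QH w (xs i) • ys i + QH w hypY • hypX + QH w hypX • hypY := hexp w hwy
  -- `w·w = 0` gives `2 αβ = 0`; `z·w = 1` gives `γ β + δ α = 1`
  have hpair : ∀ v : V × (Fin 2 → ℤ), (∀ i, QH v (ys i) = 0) →
      QH v w = QH v hypY * QH w hypX + QH v hypX * QH w hypY := by
    intro v hv
    conv_lhs => rw [hexp v hv]
    rw [map_add, map_add, LinearMap.add_apply, LinearMap.add_apply, hSv _ w hwy,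
      LinearMap.BilinForm.smul_left, LinearMap.BilinForm.smul_left, hB.eq hypX w, hB.eq hypY w,
      zero_add]
  have h1 : QH w hypY * QH w hypX + QH w hypX * QH w hypY = 0 := by rw [← hpair w hwy, hww]
  have h2 : QH z hypY * QH w hypX + QH z hypX * QH w hypY = 1 := by rw [← hpair z hzy, hzw]
  have hαβ : (QH w hypY = 0 ∧ (QH w hypX = 1 ∨ QH w hypX = -1)) ∨
      (QH w hypX = 0 ∧ (QH w hypY = 1 ∨ QH w hypY = -1)) := by
    have hmul : QH w hypY * QH w hypX = 0 := by linarith [mul_comm (QH w hypY) (QH w hypX)]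
    rcases mul_eq_zero.1 hmul with hα | hβ
    · refine Or.inl ⟨hα, Int.eq_one_or_neg_one_of_mul_eq_one (u := QH w hypX) (v := QH z hypY) ?_⟩
      rw [hα, mul_zero, add_zero] at h2
      linarith [mul_comm (QH z hypY) (QH w hypX)]
    · refine Or.inr ⟨hβ, Int.eq_one_or_neg_one_of_mul_eq_one (u := QH w hypY) (v := QH z hypX) ?_⟩
      rw [hβ, mul_zero, zero_add] at h2
      linarith [mul_comm (QH z hypX) (QH w hypY)]
  -- the endgame
  obtain ⟨η, hη, hηy, hηw⟩ := exists_isWordIn_wallGenerators_endgame hQ hyX hyY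
    (s := ∑ i, QH w (xs i) • ys i) (hSy _) (hSX _) (hSY _)
    (by rw [hB.eq]; exact hSv _ _ (hSy _)) (QH w hypY) (QH w hypX) hαβ
  refine ⟨φ.trans η, hφ.bind hgens |>.trans hη, fun i => ?_, ?_⟩
  · rw [LinearMap.BilinForm.IsometryEquiv.trans_apply, hφu, hηy]
  · rw [LinearMap.BilinForm.IsometryEquiv.trans_apply, ← hwdef]
    conv_lhs => rw [hw]
    exact hηw

/-- **What the regluing and the Lagrangian mover consume, for FULL frames** (no spare plane):
under the hypotheses of `exists_isWordIn_wallGenerators_apply_eq_std_of_fullFrame`, for every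
isometry `A` of `Q ⊕ H` and every hyperbolic `(K+1)`-frame `(u, u')` there is a word `φ` in
Kirby's generators with `φ (u i) = A (u i)` for all `i` (transport `u` and `A u` onto the standard
half-frame and compose). [cite: Kirby1989, Ch. X, proof of Thm. 1 (p. 56), proof of Thm. 2 (pp. 61–62)]
[cite: WallJLMS1964, §2, p. 145] -/
theorem exists_isWordIn_wallGenerators_apply_eq_of_fullFrame (hQ : Q.IsSymm) {K : ℕ}
    {xs ys : Fin K → V × (Fin 2 → ℤ)}
    (hxx : ∀ i j, QH (xs i) (xs j) = 0) (hyy : ∀ i j, QH (ys i) (ys j) = 0)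
    (hxy : ∀ i j, QH (xs i) (ys j) = if i = j then 1 else 0)
    (hxX : ∀ j, QH (xs j) hypX = 0) (hxY : ∀ j, QH (xs j) hypY = 0)
    (hyX : ∀ j, QH (ys j) hypX = 0) (hyY : ∀ j, QH (ys j) hypY = 0)
    (hspan : ∀ v : V × (Fin 2 → ℤ), (∀ j, QH v (xs j) = 0) → (∀ j, QH v (ys j) = 0) →
      QH v hypX = 0 → QH v hypY = 0 → v = 0)
    (A : (QH).IsometryEquiv QH) (u u' : Fin (K + 1) → V × (Fin 2 → ℤ))
    (hu : ∀ i j, QH (u i) (u j) = 0) (hu' : ∀ i j, QH (u' i) (u' j) = 0)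
    (huu' : ∀ i j, QH (u i) (u' j) = if i = j then 1 else 0) :
    ∃ φ : (QH).IsometryEquiv QH, IsWordIn (wallGenerators hQ) φ ∧ ∀ i, φ (u i) = A (u i) := by
  obtain ⟨φ₁, hφ₁, hφ₁u, hφ₁l⟩ := exists_isWordIn_wallGenerators_apply_eq_std_of_fullFrame hQ hxx hyy
    hxy hxX hxY hyX hyY hspan u u' hu hu' huu'
  obtain ⟨φ₂, hφ₂, hφ₂u, hφ₂l⟩ := exists_isWordIn_wallGenerators_apply_eq_std_of_fullFrame hQ hxx hyy
    hxy hxX hxY hyX hyY hspan (fun i => A (u i)) (fun i => A (u' i))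
    (fun i j => by rw [A.map_app, hu]) (fun i j => by rw [A.map_app, hu'])
    (fun i j => by rw [A.map_app, huu'])
  refine ⟨φ₁.trans φ₂.symm, hφ₁.trans hφ₂.symm, fun i => ?_⟩
  rw [LinearMap.BilinForm.IsometryEquiv.trans_apply]
  induction i using Fin.lastCases with
  | last =>
    rw [hφ₁l, ← hφ₂l, LinearMap.BilinForm.IsometryEquiv.symm_apply_apply]
  | cast i =>
    rw [hφ₁u, ← hφ₂u i, LinearMap.BilinForm.IsometryEquiv.symm_apply_apply]

end FullFrame

end Literature.Topology.FourManifolds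

end
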